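import Summits.FinalStateConjecture.FinalStateConjecture.Theorems.ZeroEnergyKerrOrBombZeroEnergyRigidityStubFuturePresentationPieces
import Literature.Geometry.Lorentzian.StationaryOrbitRelation

/-!
# Crux `HawkingExtensionIsKerr` (stmt-FinalStateConjecture-17840) — ideator 2: PROOF of the first
# lemma `CollarSandwich` of card `horizon-anchored-causal-sandwich`

Every point of the d.o.c. is chronologically sandwiched between two points of any non-empty
`T`-invariant subset `N ⊆ doc` (the collar anchors): `I^±(M_ext) = I^±(T·y)` for `y ∈ M_ext`
(`chronologicalFuture/Past_eq_of_invariant`, landed helpers of p115302) and flow-invariance of `≪`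
(`IsKillingField.flow_mem_chronologicalFuture_flow_iff`).
-/

noncomputable section

set_option linter.dupNamespace false

namespace Summit.FinalStateConjecture.FinalStateConjecture.Cruxes.HawkingExtensionIsKerr.SketchIdeator2

open Set Function Literature.Geometry.Lorentzian LorentzianMetric
open Summit.FinalStateConjecture.FinalStateConjecture.Theorems.ZeroEnergyRigidity.GlobalHorizonKillingField
open scoped Manifold Topology

/-- **`CollarSandwich` (card `horizon-anchored-causal-sandwich`, first lemma), proved.**
For a non-empty subset `N ⊆ ⟨⟨M_ext⟩⟩` invariant under the stationary flow, every `p ∈ ⟨⟨M_ext⟩⟩`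
satisfies `q₁ ≪ p ≪ q₂` for some `q₁, q₂ ∈ N`. Chruściel–Costa 2008, §3 (proof of Lemma 3.5:
`I^±` of an invariant part of `M_ext`); O'Neill 1983, Ch. 9, Prop. 9.23 (flows of Killing fields are
isometries) and Ch. 14, p. 402 (transitivity of `≪`). -/
theorem collarSandwich_proof :
    ∀ (𝓑 : StationaryAFBlackHole.{0}) [𝓑.metric.HasLeviCivita] (N : Set 𝓑.carrier),
      N ⊆ 𝓑.doc → N.Nonempty →
      (∀ δ : ℝ → 𝓑.carrier, IsMIntegralCurve δ 𝓑.killing → δ 0 ∈ N → ∀ s, δ s ∈ N) →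
      ∀ p ∈ 𝓑.doc, ∃ q₁ ∈ N, ∃ q₂ ∈ N,
        p ∈ 𝓑.metric.chronologicalFuture 𝓑.timeOrientation {q₁} ∧
        p ∈ 𝓑.metric.chronologicalPast 𝓑.timeOrientation {q₂} := by
  intro 𝓑 _ N hN hne hinv p hp
  obtain ⟨q, hq⟩ := hne
  have hqdoc : q ∈ 𝓑.doc := hN hq
  obtain ⟨θ, hθ, hθ0, hθadd, hθX, -, -, hMext, -⟩ := 𝓑.exists_stationary_flow
  have hK : 𝓑.metric.IsKillingField 𝓑.killing := 𝓑.isStationaryKilling.isKillingField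
  have hθ2 : ContMDiff (𝓘(ℝ, ℝ).prod (𝓡 4)) (𝓡 4) 2 θ := hθ.of_le (WithTop.coe_le_coe.mpr le_top)
  have hK1 : ContMDiff (𝓡 4) (𝓡 4).tangent 1
      (fun x ↦ (⟨x, 𝓑.killing x⟩ : TangentBundle (𝓡 4) 𝓑.carrier)) :=
    hK.contMDiff.of_le (WithTop.coe_le_coe.mpr le_top)
  -- the orbit `T·y` of a point `y ∈ M_ext`: inside `M_ext`, flow-invariant
  have horb_sub : ∀ y ∈ 𝓑.Mext, Set.range (fun t ↦ θ (t, y)) ⊆ 𝓑.Mext := by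
    rintro y hy _ ⟨t, rfl⟩
    rw [← hMext t]
    exact mem_image_of_mem _ hy
  have horb_inv : ∀ y : 𝓑.carrier, ∀ δ : ℝ → 𝓑.carrier, IsMIntegralCurve δ 𝓑.killing →
      δ 0 ∈ Set.range (fun t ↦ θ (t, y)) → ∀ s, δ s ∈ Set.range (fun t ↦ θ (t, y)) := by
    rintro y δ hδ ⟨t₀, ht₀⟩ s
    simp only at ht₀
    refine ⟨s + t₀, ?_⟩
    show θ (s + t₀, y) = δ s
    rw [← hθadd s t₀ y, ht₀, ← eq_flow_of_isMIntegralCurve hK1 hθX hθ0 hδ s]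
  -- the `T`-translates of the anchor `q` stay in `N`
  have hθq : ∀ s, θ (s, q) ∈ N :=
    fun s ↦ hinv (fun t ↦ θ (t, q)) (hθX q) (by rw [hθ0]; exact hq) s
  -- (1) future anchor: `q ≪ y₁ ∈ M_ext`, `p ∈ I⁺(M_ext) = I⁺(T·y₁)`, so `θₛ q ≪ θₛ y₁ ≪ p`
  obtain ⟨y₁, hy₁, γ₁, a₁, b₁, hab₁, hγ₁, hγ₁a, hγ₁b⟩ := hqdoc.2
  have hqy₁ : q ∈ 𝓑.metric.chronologicalPast 𝓑.timeOrientation {y₁} :=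
    ⟨y₁, rfl, γ₁, a₁, b₁, hab₁, hγ₁, hγ₁a, hγ₁b⟩
  have hy₁q : y₁ ∈ 𝓑.metric.chronologicalFuture 𝓑.timeOrientation {q} :=
    mem_chronologicalFuture_of_mem_chronologicalPast hqy₁
  have hp1 : p ∈ 𝓑.metric.chronologicalFuture 𝓑.timeOrientation (Set.range fun t ↦ θ (t, y₁)) := by
    rw [FuturePresentation.chronologicalFuture_eq_of_invariant 𝓑 (horb_sub y₁ hy₁)
      ⟨θ (0, y₁), 0, rfl⟩ (horb_inv y₁)]
    exact hp.1
  rw [LorentzianMetric.chronologicalFuture_eq_biUnion] at hp1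
  simp only [mem_iUnion, exists_prop, Set.mem_range] at hp1
  obtain ⟨_, ⟨s₁, rfl⟩, hps₁⟩ := hp1
  have h1 : θ (s₁, y₁) ∈ 𝓑.metric.chronologicalFuture 𝓑.timeOrientation {θ (s₁, q)} :=
    (hK.flow_mem_chronologicalFuture_flow_iff hθ2 hθ0 hθadd hθX s₁).2 hy₁q
  have hp₁ : p ∈ 𝓑.metric.chronologicalFuture 𝓑.timeOrientation {θ (s₁, q)} :=
    mem_chronologicalFuture_trans h1 hps₁
  -- (2) past anchor: `M_ext ∋ y₂ ≪ q`, `p ∈ I⁻(M_ext) = I⁻(T·y₂)`, so `p ≪ θₛ y₂ ≪ θₛ q`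
  obtain ⟨y₂, hy₂, γ₂, a₂, b₂, hab₂, hγ₂, hγ₂a, hγ₂b⟩ := hqdoc.1
  have hqy₂ : q ∈ 𝓑.metric.chronologicalFuture 𝓑.timeOrientation {y₂} :=
    ⟨y₂, rfl, γ₂, a₂, b₂, hab₂, hγ₂, hγ₂a, hγ₂b⟩
  have hy₂q : y₂ ∈ 𝓑.metric.chronologicalPast 𝓑.timeOrientation {q} :=
    mem_chronologicalPast_of_mem_chronologicalFuture hqy₂
  have hp2 : p ∈ 𝓑.metric.chronologicalPast 𝓑.timeOrientation (Set.range fun t ↦ θ (t, y₂)) := by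
    rw [FuturePresentation.chronologicalPast_eq_of_invariant 𝓑 (horb_sub y₂ hy₂)
      ⟨θ (0, y₂), 0, rfl⟩ (horb_inv y₂)]
    exact hp.2
  have hp2' : p ∈ 𝓑.metric.chronologicalFuture 𝓑.timeOrientation.reverse
      (Set.range fun t ↦ θ (t, y₂)) := hp2
  rw [LorentzianMetric.chronologicalFuture_eq_biUnion] at hp2'
  simp only [mem_iUnion, exists_prop, Set.mem_range] at hp2'
  obtain ⟨_, ⟨s₂, rfl⟩, hps₂⟩ := hp2'
  have h2 : θ (s₂, y₂) ∈ 𝓑.metric.chronologicalPast 𝓑.timeOrientation {θ (s₂, q)} :=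
    (hK.flow_mem_chronologicalFuture_flow_iff (τ := 𝓑.timeOrientation.reverse)
      hθ2 hθ0 hθadd hθX s₂).2 hy₂q
  have hp₂ : p ∈ 𝓑.metric.chronologicalPast 𝓑.timeOrientation {θ (s₂, q)} :=
    mem_chronologicalPast_trans h2 hps₂
  exact ⟨θ (s₁, q), hθq s₁, θ (s₂, q), hθq s₂, hp₁, hp₂⟩

end Summit.FinalStateConjecture.FinalStateConjecture.Cruxes.HawkingExtensionIsKerr.SketchIdeator2

end
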